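import Mathlib
import Summits.Schanuel.Schanuel.Theses.RigidCore
import Summits.Schanuel.Schanuel.Theorems.AclSubsetLogFreeCore.Negative.ExpAclField
import Summits.Schanuel.Schanuel.Theorems.RigidCoreMinimalCounterexampleInAclRankSplit
import Summits.Schanuel.Schanuel.Theorems.RigidCoreMinimalCounterexampleInAclPureResidue
import Summits.Schanuel.Schanuel.Theorems.RigidCoreMinimalCounterexampleInAclSecondLevelSelection
import Summits.Schanuel.Schanuel.Theorems.RigidCoreMinimalCounterexampleInAclSecondLevelSelectionProd
import Summits.Schanuel.Schanuel.Theorems.RigidCoreMinimalCounterexampleInAclSecondLevelSelectionCos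
import Summits.Schanuel.Schanuel.Theorems.RigidCoreMinimalCounterexampleInAclSecondLevelSplit
import Summits.Schanuel.Schanuel.Theorems.MinimalCounterexampleInAcl.Negative.IsolationFree
import Summits.Schanuel.Schanuel.Theorems.RigidCoreSparsityTwoWildDepthCap
import Summits.Schanuel.Schanuel.Theorems.RigidCoreMinimalCounterexampleInAclGeThreeSectors
import Summits.Schanuel.Schanuel.Theorems.RigidCoreMinimalCounterexampleInAclDefinableClassSelector
import Summits.Schanuel.Schanuel.Theorems.RigidCoreMinimalCounterexampleInAclArithmeticTransfer
import Summits.Schanuel.Schanuel.Theorems.RigidCoreMinimalCounterexampleInAclCorankGeTwoNoFullLineCurveCase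
import Summits.Schanuel.Schanuel.Theorems.RigidCoreMinimalCounterexampleInAclCosetLineSparsityOfFree
import Summits.Schanuel.Schanuel.Theorems.RigidCoreMinimalCounterexampleInAclMonomialSliceVariety
import Summits.Schanuel.Schanuel.Theorems.RigidCoreMinimalCounterexampleInAclLineVarietyDeadDirections
import Summits.Schanuel.Schanuel.Theorems.RigidCoreMinimalCounterexampleInAclNoFullLineOfCosetLineSparsity
import Summits.Schanuel.Schanuel.Theorems.RigidCoreMinimalCounterexampleInAclOfResidues
import Summits.Schanuel.Schanuel.Theorems.RigidCoreMinimalCounterexampleInAclCosetLineSparsityCurve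
import Summits.Schanuel.Schanuel.Theorems.RigidCoreMinimalCounterexampleInAclGenericSparsityOfFree
import Summits.Schanuel.Schanuel.Theorems.RigidCoreMinimalCounterexampleInAclNoFullLineOfGenericSparsity
import Summits.Schanuel.Schanuel.Theorems.RigidCoreMinimalCounterexampleInAclGenericSparsityOfFcsPlus
import Summits.Schanuel.Schanuel.Theorems.RigidCoreMinimalCounterexampleInAclCorankOne
import Summits.Schanuel.Schanuel.Theorems.RigidCoreMinimalCounterexampleInAclCorankGeTwoLogPart
import Summits.Schanuel.Schanuel.Theorems.RigidCoreMinimalCounterexampleInAclCorankGeTwoHitSetRingDefinable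
import Summits.Schanuel.Schanuel.Theorems.RigidCoreMinimalCounterexampleInAclCorankGeTwoLogPartModPeriod
import HarnessLib.Audit

/-!
# Line `kernel-arithmetic-selection` — skeleton for crux stmt-Schanuel-0969
`Summit.Schanuel.Schanuel.Theses.RigidCore.MinimalCounterexampleInAcl` (S*) — GEN 35 (lead c16, 2026-08-17)

GEN 35 (lead c16, after wave 2): ALL FOUR PROVABLE GEN-34 STUBS ARE TREE THEOREMS — the CURVE CASE `stub_cosetLineSparsity_curve`
(Theorems/…CosetLineSparsityCurve, p158309; abstract core `densityZero_of_kRelations` over any field of constants), R1♮ `stub_genericSparsity_of_free`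
(…GenericSparsityOfFree, p157937), R3♮ `stub_noFullLine_of_genericSparsity` (…NoFullLineOfGenericSparsity, p157931), `stub_genericSparsity_of_fcsPlus`
(…GenericSparsityOfFcsPlus, p157858); 894 lines, one wave.  REGISTERED STUBS (gen 35, all OPEN, research-level): `stub_pureTwistedResidue` (R₃),
`stub_genericCosetLineSparsity` (FCS♮⁺: generic free coset-line sparsity in fibre dimension ≥ 2), `stub_corankGeTwo_relResidue` (S7′)
— and the two residue equivalences modulo FCS♮⁺ are tree theorems (Theorems/…OfGenericResidues, p159089):
`stub_crux_iff_residues_of_genericSparsity` FCS♮⁺ ⟹ ((S*) ⟺ R₃ ∧ S7′), `stub_geThree_iff_relResidue_of_genericSparsity` FCS♮⁺ ⟹ (14744 ⟺ S7′);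
(S*) ⟺ R₃ ∧ S7′ and 14744 ⟺ S7′ modulo FCS♮⁺.

GEN 34 (lead c16, wave 2): THE OPEN SPARSITY STUB IS SHARPENED TO ITS K-GENERIC, NON-CURVE CORE.  Gen 31's FCS⁺ (arbitrary closed `W`)
is replaced by FCS♮⁺ `stub_genericCosetLineSparsity` — the same free coset-line sparsity, but only for families all of whose points have the
SAME TYPE over a field of constants `K` and transcendence degree EXACTLY `#T ≥ 2` over `K` (what first failures actually produce) — together
with four provable stubs: the CURVE CASE in any ambient dimension `stub_cosetLineSparsity_curve` (trdeg ≤ 1; P1 after projecting to a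
coordinate whose exponential is transcendental over `K`), the abstract reduction `stub_genericSparsity_of_free` (FCS♮⁺ ∧ curve ⟹ FCS♮, the
K-generic dimension-drop form; maximal-rank dead lattice as in R1), the glue `stub_noFullLine_of_genericSparsity` (FCS♮ ⟹ S7b, as R3 with the
type data from `exists_coordSet` / `laurent_relations_transfer`), and `stub_genericSparsity_of_fcsPlus` (FCS⁺ ⟹ FCS♮⁺: the new open stub is
WEAKER).  REGISTERED STUBS (gen 34): open `stub_pureTwistedResidue` (R₃), `stub_genericCosetLineSparsity` (FCS♮⁺), `stub_corankGeTwo_relResidue`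
(S7′); provable `stub_cosetLineSparsity_curve`, `stub_genericSparsity_of_free`, `stub_noFullLine_of_genericSparsity`, `stub_genericSparsity_of_fcsPlus`.

GEN 33 (lead c16): = gen 32 with the two residue equivalences LANDED as tree theorems (Theorems/…OfResidues, p156632):
`stub_crux_iff_residues_of_fcsPlus` — FCS⁺ ⟹ ((S*) ⟺ R₃ ∧ S7′) — and `stub_geThree_iff_relResidue_of_fcsPlus` — FCS⁺ ⟹ (item 14744 ⟺ S7′);
`MinimalCounterexampleInAcl_of := (stub_crux_iff_residues_of_fcsPlus FCS⁺).2 ⟨R₃, S7′⟩`.  REGISTERED STUBS (gen 33, all OPEN, all research-level):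
`stub_pureTwistedResidue` (R₃), `stub_freeCosetLineSparsity` (FCS⁺), `stub_corankGeTwo_relResidue` (S7′).

GEN 32 (lead c16, after wave 1): ALL FOUR REDUCTION STUBS OF GEN 31 ARE TREE THEOREMS — R1 `stub_cosetLineSparsity_of_free`
(Theorems/…CosetLineSparsityOfFree, p155985), R2α `stub_monomialSliceVariety` (Theorems/…MonomialSliceVariety, p155667), R2β
`stub_lineVariety_deadDirections` (Theorems/…LineVarietyDeadDirections, p155947), R3 `stub_noFullLine_of_cosetLineSparsity`
(Theorems/…NoFullLineOfCosetLineSparsity, p155723); 983 lines, one wave.  S7b is the sorry-free `corankGeTwo_noFullLine_of_stubs` over the single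
open stub FCS⁺.  REGISTERED STUBS (gen 32): `stub_pureTwistedResidue` (R₃), `stub_freeCosetLineSparsity` (FCS⁺), `stub_corankGeTwo_relResidue` (S7′) —
three NAMED research statements, nothing ad hoc: (S*) ⟸ R₃ ∧ FCS⁺ ∧ S7′ (`MinimalCounterexampleInAcl_of`), item 14744 ⟸ FCS⁺ ∧ S7′ (`geThree_of_stubs`).

GEN 31 (lead c16): S7b `stub_corankGeTwo_noFullLine` (no full line of mates in a log direction at corank ≥ 2) is RESHAPED
into its research core and a formal reduction — the reduction that the obstruction note
`Lines/kernel_arithmetic_selection_S7b_obstruction.md` §5(iii) costed at ≈ 1200 lines and left unscheduled, in a field-free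
form that avoids the stage-wise descent:

* `stub_freeCosetLineSparsity` — FCS⁺, FREE COSET-LINE SPARSITY MODULO DEAD DIRECTIONS (OPEN, research-level; Zilber–Pink type
  for the exponential graph), stated for an arbitrary finite index type `ι` with a distinguished coset coordinate `i₀` (lead c14's
  type-checked `FCSplus` of `Lines/kernel_arithmetic_selection_FCSplus.lean` is the instance `ι = Fin (k+1)`, `i₀ = 0`);
* `stub_cosetLineSparsity_of_free` (R1, abstract, PROVABLE): FCS⁺ ⟹ the DIMENSION-DROP form FCS♭ — a fibre-finite coset family
  of ℚ-linearly independent exponential points has upper Banach density zero as soon as, along every sub-family of positive upper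
  Banach density and for every lattice `Λ` of directions constant ("dead") along it, the family lies on a Zariski closed `W` with
  `dim W + rank Λ < #ι` (maximal-rank dead lattice + partition regularity of upper Banach density; no field theory);
* `stub_monomialSliceVariety` (R2α, abstract algebra, PROVABLE): the `ℚ(b, e^b)`-locus of a point `P_{j₀} ∈ ℂⁿ × (ℂˣ)ⁿ`
  (`b = M·z` integer combinations, `e^b = y^M` Laurent monomials) is Zariski closed of dimension `≤ #T` whenever every coordinate of
  `P_{j₀}` is algebraic over `ℚ[b, e^b, T]`, and contains every point with the same ℚ-relations and the same values of `b`, `y^M`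
  (clearing Laurent denominators + `zariskiDim_kLocus_le`, Theorems/…NoFullLineSlice);
* `stub_lineVariety_deadDirections` (R2β, first-failure side, PROVABLE; LEAD): R2α ⟹ for a family of mates of a first failure `x`
  of rank `n` and a lattice `Λ` of directions dead along it, a Zariski closed `W ⊇` the family with `dim W + rank Λ < n`
  (`SchanuelRank (rank Λ)` on the ℚ-independent constants `b`, counted inside `ℚ(x', e^{x'})` of transcendence degree `n − 1`);
* `stub_noFullLine_of_cosetLineSparsity` (R3, glue, PROVABLE): FCS♭ ⟹ R2β's conclusion ⟹ S7b (a full line of mates is a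
  fibre-finite coset family over `dℤ`, of upper Banach density `1/|d| > 0`).

Composition (sorry-free over the stubs): `corankGeTwo_noFullLine_of_stubs` = R3 (R1 FCS⁺) (R2β R2α) is S7b verbatim, and the
gen-28 composition is unchanged downstream.  After R1, R2α, R2β, R3 land, the crux's open set is exactly three NAMED research
statements: R₃ (⟸ stmt-0971's residual atoms), FCS⁺, S7′ (relative pure isolation ⟸ uniform relative fibre finiteness).

GEN 30 (lead c14): registered stubs R₃, S7b, S7′; sorry-free `crux_iff_threeNecessaryResidues` ((S*) ⟺ R₃ ∧ L ∧ S7′, all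
necessary; S7b only a sufficient route to L); unconditional mod-period selector `stub_corankGeTwo_logCombosModPeriod` (p150129).
GEN 29/28 (lead c13): S7a `stub_corankGeTwo_hitSetRingDefinable` is a TREE THEOREM; S7 = S7a ∧ S7b ∧ S7′ via the landed
`corankGeTwo_of_pieces`; P1 `stub_cosetLine_densityZero_corankOne` (p143617) and P2 `stub_corankGeTwo_noFullLine_curveCase`
(p146237) are the `k = 1` / curve-case theorems of which FCS⁺ is the `k`-dimensional density form.  GEN 27 (lead c12): the
corank-ONE sector of item 14744 is a theorem (`corankOne_holds`, p139100).  Levers 1–3 (gens 1–19d): log sector every rank, rank-2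
mixed sector, rank-2 gadget selection — all landed.  Idea cards `Ideas/kernel-arithmetic-selection.md`, `Ideas/arithmetic-isolation.md`;
status note `Lines/kernel_arithmetic_selection.md`; `PICKED.md`.

REGISTERED STUBS (gen 35; `sorry` ONLY here): `stub_pureTwistedResidue` (R₃), `stub_corankGeTwo_relResidue` (S7′), `stub_genericCosetLineSparsity` (FCS♮⁺).

DISPROOF READ (tree `Cruxes/…/Disproof.lean` gen 4 + DisproofNoArc + DisproofRankTwo, unchanged since 2026-08-16T05:26Z; re-read
by c16 10:30Z): load-bearing hypotheses kept (every first-failure stub carries the full `firstFailures n` bundle; R2β uses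
`SchanuelRank (rank Λ) < n` and `trdeg < n` — both load-bearing by `not_withoutTrdeg`); no uniform stub (§9); no `-- Targets`
entry addresses R₃ / S7b / S7′ / FCS⁺.
-/

noncomputable section

set_option linter.dupNamespace false

open Complex Set FirstOrder Filter Topology Polynomial

namespace Summit.Schanuel.Schanuel.Cruxes.MinimalCounterexampleInAcl.KernelArithmeticSelection

open Literature.NumberTheory.Transcendental (SchanuelRank IsDefinedOver zariskiDim IsZariskiClosed)
open Literature.ModelTheory.ExponentialFields
open Summit.Schanuel.Schanuel.Theorems
open Summit.Schanuel.Schanuel.Theorems.AclSubsetLogFreeCore.Negative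

variable {n : ℕ}

/-! ## The registered stubs (gen 35) — `sorry` lives ONLY here -/

/-- **Stub R₃ — THE PURE GADGET-GENERIC RESIDUE (OPEN).**  (S*) at rank 2 for PURE first failures (`e^{Σ Mᵢxᵢ}` transcendental for
every non-zero integer vector `M`) at which the gadgets `e^{x₀²}`, `e^{x₀x₁}`, `e^{x₁²}`, `e^{ix₀}`, `e^{ix₁}` are ALL transcendental over
`K = ℚ(x, eˣ)`.  Implied by `PureSparsityTwo` (gen 17) and by the gen-19/19c residues; SC(2) predicts it is vacuous. -/
theorem stub_pureTwistedResidue : ∀ (x : Fin 2 → ℂ), x ∈ Summit.Schanuel.Schanuel.Cruxes.MinimalCounterexampleInAcl.KernelArithmeticSelection.firstFailures 2 → (∀ M : Fin 2 → ℤ, M ≠ 0 → Transcendental ℚ (Complex.exp (∑ i, (M i : ℂ) * x i))) → Transcendental ↥(IntermediateField.adjoin ℚ (Set.range x ∪ Set.range (Complex.exp ∘ x))) (Complex.exp (x 0 ^ 2)) → Transcendental ↥(IntermediateField.adjoin ℚ (Set.range x ∪ Set.range (Complex.exp ∘ x))) (Complex.exp (x 0 * x 1)) → Transcendental ↥(IntermediateField.adjoin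 ℚ (Set.range x ∪ Set.range (Complex.exp ∘ x))) (Complex.exp (x 1 ^ 2)) → Transcendental ↥(IntermediateField.adjoin ℚ (Set.range x ∪ Set.range (Complex.exp ∘ x))) (Complex.exp (Complex.I * x 0)) → Transcendental ↥(IntermediateField.adjoin ℚ (Set.range x ∪ Set.range (Complex.exp ∘ x))) (Complex.exp (Complex.I * x 1)) → ∀ i, x i ∈ Summit.Schanuel.Schanuel.Theorems.AclSubsetLogFreeCore.Negative.expAcl := by
  sorry

/-- **Stub S7′ — RELATIVE PURE ISOLATION (corank ≥ 2; OPEN, crux-sized).**  For a normal-form first failure `x` of rank `n ≥ 3` with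
`r ≤ n − 2` log directions whose LOG COORDINATES are already in `acl(∅)`, every coordinate is in `acl(∅)`.  Implied by uniform
finiteness of the relative pure fibres (`stub_corankGeTwo_relResidue_of_fibresFinite` below, sorry-free). -/
theorem stub_corankGeTwo_relResidue : ∀ (n r : ℕ), 3 ≤ n → r + 2 ≤ n → ∀ (x : Fin n → ℂ), x ∈ Summit.Schanuel.Schanuel.Cruxes.MinimalCounterexampleInAcl.KernelArithmeticSelection.firstFailures n → (∀ i : Fin n, (i : ℕ) < r → IsAlgebraic ℚ (Complex.exp (x i))) → (∀ M : Fin n → ℤ, (∃ i : Fin n, r ≤ (i : ℕ) ∧ M i ≠ 0) → Transcendental ℚ (Complex.exp (∑ i, (M i : ℂ) * x i))) → (∀ i : Fin n, (i : ℕ) < r → x i ∈ Summit.Schanuel.Schanuel.Theorems.AclSubsetLogFreeCore.Negative.expAcl) → ∀ i, x i ∈ Summit.Schanuel.Schanuel.Theorems.AclSubsetLogFreeCore.Negative.expAcl := by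
  sorry

/-- **Stub FCS♮⁺ — GENERIC FREE COSET-LINE SPARSITY IN FIBRE DIMENSION ≥ 2 (OPEN, research-level; gen 34).**  The K-GENERIC,
NON-CURVE form of free coset-line sparsity: for a finite index type `ι` with a distinguished coset coordinate `i₀`, let
`q : ℤ → ℂ^ι` be, along `J ⊆ ℤ`, a family of ℚ-linearly independent points over the coset `c + 2πiℤ` in the coordinate `i₀`, meeting every
exponential fibre finitely, and let `Λ ≤ ℤ^ι` be a lattice of directions constant along `J`.  Suppose all the points `P_j = (q_j, e^{q_j})`
have the SAME TYPE over the field of constants `K = ℚ(ev)` (every ℚ-polynomial relation of `(ev, P_{j₀})` holds at `(ev, P_j)` and conversely),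
that `P_{j₀}` has transcendence degree exactly `#T ≥ 2` over `K`, witnessed by a `K`-algebraically independent set `T` of its coordinates over
which all its coordinates are algebraic, with `#T + rank Λ < #ι`, and that the family is FREE MODULO `Λ` along every sub-family of positive
upper Banach density.  Then `J` has upper Banach density zero.  WEAKER than gen 31's FCS⁺ `stub_freeCosetLineSparsity` (arbitrary closed `W`;
`stub_genericSparsity_of_fcsPlus`), and the curve case (transcendence degree ≤ 1, any `ι`) is carved off as the provable
`stub_cosetLineSparsity_curve`.  First open instance: `#ι = 3`, `Λ = ⊥`, `#T = 2` (a first failure of rank 3 with one log coordinate).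
Expected TRUE (Ax–Schanuel heuristic); a proof would need height control of the hits + o-minimal point counting + Ax–Lindemann for `exp`. -/
theorem stub_genericCosetLineSparsity : ∀ (ι : Type) [Fintype ι] (i₀ : ι) (c : ℂ) (J : Set ℤ) (q : ℤ → ι → ℂ) (Λ : Submodule ℤ (ι → ℤ)) (κ : Type) (ev : κ → ℂ) (j₀ : ℤ) (T : Finset (ι ⊕ ι)), j₀ ∈ J → 2 ≤ T.card → T.card + Module.finrank ℤ ↥Λ < Fintype.card ι → (∀ j ∈ J, LinearIndependent ℚ (q j) ∧ q j i₀ = c + 2 * ↑Real.pi * Complex.I * (j : ℂ)) → (∀ ω : ι → ℂ, Set.Finite {j : ℤ | j ∈ J ∧ Complex.exp ∘ q j = ω}) → (∀ M ∈ Λ, ∀ j ∈ J, ∀ j' ∈ J, (∑ i, (M i : ℂ) * q j i) = ∑ i, (M i : ℂ) * q j' i) → (∀ j ∈ J, ∀ H : MvPolynomial (κ ⊕ (ι ⊕ ι)) ℚ, MvPolynomial.aeval (Sum.elim ev (Sum.elim (q j₀) (Complex.exp ∘ q j₀))) H = 0 ↔ MvPolynomial.aeval (Sum.elim ev (Sum.elim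 (q j) (Complex.exp ∘ q j))) H = 0) → AlgebraicIndependent ↥(IntermediateField.adjoin ℚ (Set.range ev)) (fun t : ↥T => Sum.elim (q j₀) (Complex.exp ∘ q j₀) (↑t : ι ⊕ ι)) → (∀ v : ι ⊕ ι, IsAlgebraic ↥(Algebra.adjoin ↥(IntermediateField.adjoin ℚ (Set.range ev)) ((Sum.elim (q j₀) (Complex.exp ∘ q j₀)) '' (↑T : Set (ι ⊕ ι)))) (Sum.elim (q j₀) (Complex.exp ∘ q j₀) v)) → (∀ J' ⊆ J, (∃ δ : ℝ, 0 < δ ∧ ∀ N₀ : ℕ, ∃ N : ℕ, N₀ ≤ N ∧ ∃ a : ℤ, δ * (N : ℝ) ≤ (Set.ncard {j : ℤ | j ∈ Finset.Ico a (a + (N : ℤ)) ∧ j ∈ J'} : ℝ)) → ∀ M : ι → ℤ, (∀ m : ℤ, m ≠ 0 → m • M ∉ Λ) → Set.Infinite ((fun j => ∑ i, (M i : ℂ) * q j i) '' J')) → ∀ δ : ℝ, 0 < δ → ∃ N₀ : ℕ, ∀ N : ℕ, N₀ ≤ N → ∀ a : ℤ, (Set.ncard {j : ℤ | j ∈ Finset.Ico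 a (a + (N : ℤ)) ∧ j ∈ J} : ℝ) < δ * (N : ℝ) := by
  sorry

/-! ## Gen 35 composition of S7b (sorry-free over FCS♮⁺; curve case, R1♮, R3♮ are tree theorems) -/

/-- **S7b — NO FULL LINE IN A LOG DIRECTION (corank ≥ 2)**, verbatim the gen-28…30 registered signature, DERIVED from the single open
sparsity stub FCS♮⁺ through the LANDED K-generic reduction: R3♮ `stub_noFullLine_of_genericSparsity` (p157931) applied to R1♮
`stub_genericSparsity_of_free` (p157937) at FCS♮⁺ and the landed CURVE CASE `stub_cosetLineSparsity_curve` (p158309). -/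
theorem corankGeTwo_noFullLine_of_stubs : ∀ (n r : ℕ), 3 ≤ n → r + 2 ≤ n → ∀ (x : Fin n → ℂ), x ∈ Summit.Schanuel.Schanuel.Cruxes.MinimalCounterexampleInAcl.KernelArithmeticSelection.firstFailures n → (∀ i : Fin n, (i : ℕ) < r → IsAlgebraic ℚ (Complex.exp (x i))) → (∀ M : Fin n → ℤ, (∃ i : Fin n, r ≤ (i : ℕ) ∧ M i ≠ 0) → Transcendental ℚ (Complex.exp (∑ i, (M i : ℂ) * x i))) → ∀ μ : Fin n → ℤ, (∀ i : Fin n, r ≤ (i : ℕ) → μ i = 0) → μ ≠ 0 → ∃ j : ℤ, ¬ ∃ x' ∈ Summit.Schanuel.Schanuel.Cruxes.MinimalCounterexampleInAcl.KernelArithmeticSelection.locusMates x, ∀ i : Fin n, (i : ℕ) < r → x' i = x i + 2 * ↑Real.pi * Complex.I * ((j • μ) i : ℂ) :=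
  stub_noFullLine_of_genericSparsity
    (stub_genericSparsity_of_free stub_genericCosetLineSparsity stub_cosetLineSparsity_curve)

/-- Read-back (gen 35, tree): the CURVE CASE of coset-line sparsity in any ambient dimension is a theorem (p158309; abstract core
`densityZero_of_kRelations` over any field of constants `K`). -/
example : ∀ (ι : Type) [Fintype ι] (i₀ : ι) (c : ℂ) (J : Set ℤ) (q : ℤ → ι → ℂ), (∀ j ∈ J, LinearIndependent ℚ (q j) ∧ q j i₀ = c + 2 * ↑Real.pi * Complex.I * (j : ℂ)) → (∀ ω : ι → ℂ, Set.Finite {j : ℤ | j ∈ J ∧ Complex.exp ∘ q j = ω}) → (∃ (κ : Type) (ev : κ → ℂ) (j₀ : ℤ) (T : Finset (ι ⊕ ι)), j₀ ∈ J ∧ T.card ≤ 1 ∧ (∀ j ∈ J, ∀ H : MvPolynomial (κ ⊕ (ι ⊕ ι)) ℚ, MvPolynomial.aeval (Sum.elim ev (Sum.elim (q j₀) (Complex.exp ∘ q j₀))) H = 0 ↔ MvPolynomial.aeval (Sum.elim ev (Sum.elim (q j) (Complex.exp ∘ q j))) H = 0) ∧ (∀ v : ι ⊕ ι, IsAlgebraic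 ↥(Algebra.adjoin ↥(IntermediateField.adjoin ℚ (Set.range ev)) ((Sum.elim (q j₀) (Complex.exp ∘ q j₀)) '' (↑T : Set (ι ⊕ ι)))) (Sum.elim (q j₀) (Complex.exp ∘ q j₀) v))) → ∀ δ : ℝ, 0 < δ → ∃ N₀ : ℕ, ∀ N : ℕ, N₀ ≤ N → ∀ a : ℤ, (Set.ncard {j : ℤ | j ∈ Finset.Ico a (a + (N : ℤ)) ∧ j ∈ J} : ℝ) < δ * (N : ℝ) :=
  stub_cosetLineSparsity_curve

/-- Read-back (gen 35, tree): the gen-34 open stub FCS♮⁺ is WEAKER than gen 31's FCS⁺ (`stub_genericSparsity_of_fcsPlus`, p157858). -/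
example (hF : ∀ (ι : Type) [Fintype ι] (i₀ : ι) (W : Set (ι ⊕ ι → ℂ)) (c : ℂ) (J : Set ℤ) (q : ℤ → ι → ℂ) (Λ : Submodule ℤ (ι → ℤ)), Literature.NumberTheory.Transcendental.IsZariskiClosed ℂ W → Literature.NumberTheory.Transcendental.zariskiDim ℂ W + ((Module.finrank ℤ ↥Λ : ℕ) : WithBot ℕ∞) < ((Fintype.card ι : ℕ) : WithBot ℕ∞) → (∀ j ∈ J, LinearIndependent ℚ (q j) ∧ Sum.elim (q j) (Complex.exp ∘ q j) ∈ W ∧ q j i₀ = c + 2 * ↑Real.pi * Complex.I * (j : ℂ)) → (∀ ω : ι → ℂ, Set.Finite {j : ℤ | j ∈ J ∧ Complex.exp ∘ q j = ω}) → (∀ M ∈ Λ, ∀ j ∈ J, ∀ j' ∈ J, (∑ i, (M i : ℂ) * q j i) = ∑ i, (M i : ℂ) * q j' i) → (∀ J' ⊆ J, (∃ δ : ℝ, 0 < δ ∧ ∀ N₀ : ℕ, ∃ N : ℕ, N₀ ≤ N ∧ ∃ a : ℤ, δ * (N : ℝ) ≤ (Set.ncard {j : ℤ | j ∈ Finset.Ico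 a (a + (N : ℤ)) ∧ j ∈ J'} : ℝ)) → ∀ M : ι → ℤ, (∀ m : ℤ, m ≠ 0 → m • M ∉ Λ) → Set.Infinite ((fun j => ∑ i, (M i : ℂ) * q j i) '' J')) → ∀ δ : ℝ, 0 < δ → ∃ N₀ : ℕ, ∀ N : ℕ, N₀ ≤ N → ∀ a : ℤ, (Set.ncard {j : ℤ | j ∈ Finset.Ico a (a + (N : ℤ)) ∧ j ∈ J} : ℝ) < δ * (N : ℝ)) : ∀ (ι : Type) [Fintype ι] (i₀ : ι) (c : ℂ) (J : Set ℤ) (q : ℤ → ι → ℂ) (Λ : Submodule ℤ (ι → ℤ)) (κ : Type) (ev : κ → ℂ) (j₀ : ℤ) (T : Finset (ι ⊕ ι)), j₀ ∈ J → 2 ≤ T.card → T.card + Module.finrank ℤ ↥Λ < Fintype.card ι → (∀ j ∈ J, LinearIndependent ℚ (q j) ∧ q j i₀ = c + 2 * ↑Real.pi * Complex.I * (j : ℂ)) → (∀ ω : ι → ℂ, Set.Finite {j : ℤ | j ∈ J ∧ Complex.exp ∘ q j = ω}) → (∀ M ∈ Λ, ∀ j ∈ J, ∀ j' ∈ J,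 (∑ i, (M i : ℂ) * q j i) = ∑ i, (M i : ℂ) * q j' i) → (∀ j ∈ J, ∀ H : MvPolynomial (κ ⊕ (ι ⊕ ι)) ℚ, MvPolynomial.aeval (Sum.elim ev (Sum.elim (q j₀) (Complex.exp ∘ q j₀))) H = 0 ↔ MvPolynomial.aeval (Sum.elim ev (Sum.elim (q j) (Complex.exp ∘ q j))) H = 0) → AlgebraicIndependent ↥(IntermediateField.adjoin ℚ (Set.range ev)) (fun t : ↥T => Sum.elim (q j₀) (Complex.exp ∘ q j₀) (↑t : ι ⊕ ι)) → (∀ v : ι ⊕ ι, IsAlgebraic ↥(Algebra.adjoin ↥(IntermediateField.adjoin ℚ (Set.range ev)) ((Sum.elim (q j₀) (Complex.exp ∘ q j₀)) '' (↑T : Set (ι ⊕ ι)))) (Sum.elim (q j₀) (Complex.exp ∘ q j₀) v)) → (∀ J' ⊆ J, (∃ δ : ℝ, 0 < δ ∧ ∀ N₀ : ℕ, ∃ N : ℕ, N₀ ≤ N ∧ ∃ a : ℤ, δ * (N : ℝ) ≤ (Set.ncard {j : ℤ | j ∈ Finset.Ico a (a + (N : ℤ)) ∧ j ∈ J'} :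 ℝ)) → ∀ M : ι → ℤ, (∀ m : ℤ, m ≠ 0 → m • M ∉ Λ) → Set.Infinite ((fun j => ∑ i, (M i : ℂ) * q j i) '' J')) → ∀ δ : ℝ, 0 < δ → ∃ N₀ : ℕ, ∀ N : ℕ, N₀ ≤ N → ∀ a : ℤ, (Set.ncard {j : ℤ | j ∈ Finset.Ico a (a + (N : ℤ)) ∧ j ∈ J} : ℝ) < δ * (N : ℝ) :=
  stub_genericSparsity_of_fcsPlus hF

/-- Read-back (gen 32, tree): S7b also follows from gen 31's FCS⁺ through the LANDED R3 (R1 ·) (R2β R2α)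
(`corankGeTwo_noFullLine_of_fcsPlus`, Theorems/…OfResidues); with `stub_genericSparsity_of_fcsPlus` the gen-34 chain is the finer one. -/
example (hF : ∀ (ι : Type) [Fintype ι] (i₀ : ι) (W : Set (ι ⊕ ι → ℂ)) (c : ℂ) (J : Set ℤ) (q : ℤ → ι → ℂ) (Λ : Submodule ℤ (ι → ℤ)), Literature.NumberTheory.Transcendental.IsZariskiClosed ℂ W → Literature.NumberTheory.Transcendental.zariskiDim ℂ W + ((Module.finrank ℤ ↥Λ : ℕ) : WithBot ℕ∞) < ((Fintype.card ι : ℕ) : WithBot ℕ∞) → (∀ j ∈ J, LinearIndependent ℚ (q j) ∧ Sum.elim (q j) (Complex.exp ∘ q j) ∈ W ∧ q j i₀ = c + 2 * ↑Real.pi * Complex.I * (j : ℂ)) → (∀ ω : ι → ℂ, Set.Finite {j : ℤ | j ∈ J ∧ Complex.exp ∘ q j = ω}) → (∀ M ∈ Λ, ∀ j ∈ J, ∀ j' ∈ J, (∑ i, (M i : ℂ) * q j i) = ∑ i, (M i : ℂ) * q j' i) → (∀ J' ⊆ J, (∃ δ : ℝ, 0 < δ ∧ ∀ N₀ : ℕ,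 ∃ N : ℕ, N₀ ≤ N ∧ ∃ a : ℤ, δ * (N : ℝ) ≤ (Set.ncard {j : ℤ | j ∈ Finset.Ico a (a + (N : ℤ)) ∧ j ∈ J'} : ℝ)) → ∀ M : ι → ℤ, (∀ m : ℤ, m ≠ 0 → m • M ∉ Λ) → Set.Infinite ((fun j => ∑ i, (M i : ℂ) * q j i) '' J')) → ∀ δ : ℝ, 0 < δ → ∃ N₀ : ℕ, ∀ N : ℕ, N₀ ≤ N → ∀ a : ℤ, (Set.ncard {j : ℤ | j ∈ Finset.Ico a (a + (N : ℤ)) ∧ j ∈ J} : ℝ) < δ * (N : ℝ)) : ∀ (n r : ℕ), 3 ≤ n → r + 2 ≤ n → ∀ (x : Fin n → ℂ), x ∈ Summit.Schanuel.Schanuel.Cruxes.MinimalCounterexampleInAcl.KernelArithmeticSelection.firstFailures n → (∀ i : Fin n, (i : ℕ) < r → IsAlgebraic ℚ (Complex.exp (x i))) → (∀ M : Fin n → ℤ, (∃ i : Fin n, r ≤ (i : ℕ) ∧ M i ≠ 0) → Transcendental ℚ (Complex.exp (∑ i, (M i : ℂ) * x i))) → ∀ μ : Fin n → ℤ, (∀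 i : Fin n, r ≤ (i : ℕ) → μ i = 0) → μ ≠ 0 → ∃ j : ℤ, ¬ ∃ x' ∈ Summit.Schanuel.Schanuel.Cruxes.MinimalCounterexampleInAcl.KernelArithmeticSelection.locusMates x, ∀ i : Fin n, (i : ℕ) < r → x' i = x i + 2 * ↑Real.pi * Complex.I * ((j • μ) i : ℂ) :=
  corankGeTwo_noFullLine_of_fcsPlus hF

/-- Read-back (gen 32, tree): the first-failure dimension drop is UNCONDITIONAL (landed R2β over landed R2α). -/
example : ∀ (n : ℕ) (x : Fin n → ℂ), x ∈ Summit.Schanuel.Schanuel.Cruxes.MinimalCounterexampleInAcl.KernelArithmeticSelection.firstFailures n → ∀ (J : Set ℤ) (xm : ℤ → Fin n → ℂ), (∀ j ∈ J, xm j ∈ Summit.Schanuel.Schanuel.Cruxes.MinimalCounterexampleInAcl.KernelArithmeticSelection.locusMates x) → (∃ j ∈ J, ∃ j' ∈ J, xm j ≠ xm j') → ∀ Λ : Submodule ℤ (Fin n → ℤ), (∀ M ∈ Λ, ∀ j ∈ J, ∀ j' ∈ J, (∑ i, (M i : ℂ) * xm j i) = ∑ i, (M i : ℂ) * xm j' i)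 → ∃ W : Set (Fin n ⊕ Fin n → ℂ), Literature.NumberTheory.Transcendental.IsZariskiClosed ℂ W ∧ Literature.NumberTheory.Transcendental.zariskiDim ℂ W + ((Module.finrank ℤ ↥Λ : ℕ) : WithBot ℕ∞) < ((n : ℕ) : WithBot ℕ∞) ∧ ∀ j ∈ J, Sum.elim (xm j) (Complex.exp ∘ xm j) ∈ W :=
  stub_lineVariety_deadDirections stub_monomialSliceVariety

/-! ## Gen 28 glue (sorry-free): S7 from S7a ∧ S7b ∧ S7′ through the landed `corankGeTwo_of_pieces`; item 14744 ⟺ S7; (S*) ⟺ R₃ ∧ S7 -/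

/-- **S7 — (S*) IN RANKS ≥ 3, CORANK ≥ 2 — from the stubs** (landed composition `corankGeTwo_of_pieces`,
Theorems/…CorankGeTwoLogPart: ring-definable pattern ⟹ transfer ⟹ definable-class selector without full lines ⟹ log coordinates in
`acl(∅)` ⟹ relative pure isolation). -/
theorem corankGeTwo_of_stubs : ∀ (n r : ℕ), 3 ≤ n → r + 2 ≤ n → ∀ x : Fin n → ℂ, x ∈ firstFailures n →
    (∀ i : Fin n, (i : ℕ) < r → IsAlgebraic ℚ (cexp (x i))) →
    (∀ M : Fin n → ℤ, (∃ i : Fin n, r ≤ (i : ℕ) ∧ M i ≠ 0) → Transcendental ℚ (cexp (∑ i, (M i : ℂ) * x i))) →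
    ∀ i, x i ∈ expAcl :=
  corankGeTwo_of_pieces
    (fun n r hn hr x hx halg hpure =>
      @stub_corankGeTwo_hitSetRingDefinable n r hn hr x hx halg hpure (FirstOrder.Ring.compatibleRingOfRing ℤ))
    corankGeTwo_noFullLine_of_stubs stub_corankGeTwo_relResidue

/-- **(S*) IN RANKS ≥ 3 (item stmt-14744) from the stubs** (`geThree_iff_corankGeTwo`, Theorems/…CorankOne). -/
theorem geThree_of_stubs : Summit.Schanuel.Schanuel.Theses.RigidCore.MinimalCounterexampleInAclGeThree :=
  geThree_iff_corankGeTwo.2 corankGeTwo_of_stubs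

/-- **THE LOG PART OF EVERY CORANK ≥ 2 FIRST FAILURE IS IN `acl(∅)` modulo S7b alone** (S7a is a tree theorem; the landed
`logCoords_mem_expAcl_of_ringDefinable_of_noFullLine`). -/
theorem corankGeTwo_logCoords_of_stubs : ∀ (n r : ℕ), 3 ≤ n → r + 2 ≤ n → ∀ x : Fin n → ℂ, x ∈ firstFailures n →
    (∀ i : Fin n, (i : ℕ) < r → IsAlgebraic ℚ (cexp (x i))) →
    (∀ M : Fin n → ℤ, (∃ i : Fin n, r ≤ (i : ℕ) ∧ M i ≠ 0) → Transcendental ℚ (cexp (∑ i, (M i : ℂ) * x i))) →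
    ∀ i : Fin n, (i : ℕ) < r → x i ∈ expAcl :=
  fun n r hn hr x hx halg hpure =>
    logCoords_mem_expAcl_of_ringDefinable_of_noFullLine (by omega) hx.1 halg
      (@stub_corankGeTwo_hitSetRingDefinable n r hn hr x hx halg hpure (FirstOrder.Ring.compatibleRingOfRing ℤ))
      (corankGeTwo_noFullLine_of_stubs n r hn hr x hx halg hpure)

/-- **S7′ from UNIFORM FINITENESS OF THE RELATIVE PURE FIBRES** (sorry-free; the landed `mem_expAcl_of_logAcl_of_fibresFinite`). -/
theorem stub_corankGeTwo_relResidue_of_fibresFinite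
    (hF : ∀ (n r : ℕ), 3 ≤ n → r + 2 ≤ n → ∀ x : Fin n → ℂ, x ∈ firstFailures n →
      (∀ i : Fin n, (i : ℕ) < r → IsAlgebraic ℚ (cexp (x i))) →
      (∀ M : Fin n → ℤ, (∃ i : Fin n, r ≤ (i : ℕ) ∧ M i ≠ 0) → Transcendental ℚ (cexp (∑ i, (M i : ℂ) * x i))) →
      ∀ y ∈ locusMates x, {x' ∈ locusMates x | ∀ i : Fin n, (i : ℕ) < r → x' i = y i}.Finite) :
    ∀ (n r : ℕ), 3 ≤ n → r + 2 ≤ n → ∀ x : Fin n → ℂ, x ∈ firstFailures n →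
      (∀ i : Fin n, (i : ℕ) < r → IsAlgebraic ℚ (cexp (x i))) →
      (∀ M : Fin n → ℤ, (∃ i : Fin n, r ≤ (i : ℕ) ∧ M i ≠ 0) → Transcendental ℚ (cexp (∑ i, (M i : ℂ) * x i))) →
      (∀ i : Fin n, (i : ℕ) < r → x i ∈ expAcl) → ∀ i, x i ∈ expAcl :=
  fun n r hn hr x hx halg hpure hlog => mem_expAcl_of_logAcl_of_fibresFinite hx.1 hlog (hF n r hn hr x hx halg hpure)

/-- Read-back: the corank-one sector is a tree theorem (registered `stub_corankOneSector`, Theorems/…CorankOne). -/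
example : ∀ m : ℕ, 2 ≤ m → ∀ x : Fin (m + 1) → ℂ, x ∈ firstFailures (m + 1) →
    (∀ i : Fin (m + 1), (i : ℕ) < m → IsAlgebraic ℚ (cexp (x i))) →
    (∀ M : Fin (m + 1) → ℤ, M (Fin.last m) ≠ 0 → Transcendental ℚ (cexp (∑ i, (M i : ℂ) * x i))) →
    ∀ i, x i ∈ expAcl :=
  corankOne_holds

/-- Read-back: the FCS⁺ instance `#ι = 2`, `Λ = ⊥` in hit-set form is the landed P1 (Theorems/…CosetLineDensityZero, p143617). -/
example : ∀ (W : Set (Fin 2 ⊕ Fin 2 → ℂ)) (Q : Set (Fin 2 → ℂ)) (c : ℂ), IsZariskiClosed ℂ W → zariskiDim ℂ W < 2 →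
    Q ⊆ Literature.NumberTheory.Transcendental.indepExpPoints W →
    (∀ ω : Fin 2 → ℂ, Set.Finite {x : Fin 2 → ℂ | x ∈ Q ∧ cexp ∘ x = ω}) →
    ∀ δ : ℝ, 0 < δ → ∃ N₀ : ℕ, ∀ N : ℕ, N₀ ≤ N → ∀ a : ℤ,
      (Set.ncard {j : ℤ | j ∈ Finset.Ico a (a + (N : ℤ)) ∧ ∃ x ∈ Q, x 0 = c + 2 * ↑Real.pi * I * (j : ℂ)} : ℝ) < δ * (N : ℝ) :=
  stub_cosetLine_densityZero_corankOne

/-! ## Vocabulary read-back -/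

example {x x' : Fin n → ℂ} : x' ∈ locusMates x ↔ LinearIndependent ℚ x' ∧ x' ∈ locusPts x := Iff.rfl

example {x : Fin n → ℂ} : x ∈ firstFailures n ↔
    LinearIndependent ℚ x ∧
    Algebra.trdeg ℚ ↥(IntermediateField.adjoin ℚ (range x ∪ range (cexp ∘ x))) < (n : Cardinal) ∧
    ∀ r < n, SchanuelRank r := Iff.rfl

example {a : ℂ} : a ∈ expAcl ↔ ∃ s : Set ℂ, s.Finite ∧ Set.Definable₁ (∅ : Set ℂ) Language.expRing s ∧ a ∈ s := Iff.rfl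

/-! ## The composition: the ONLY theorem of this file concluding the crux, BY NAME -/

/-- **(S*) from the stubs**, via the landed `crux_of_pureTwistedResidue_of_corankGeTwo` (Theorems/…CorankOne, gen 27) and the
composition `corankGeTwo_of_stubs`: log sector every rank, mixed sector rank 2, gadget selection rank 2 and the corank-one sector of
every rank ≥ 3 are tree theorems; the pure gadget-generic rank-2 residue is Stub R₃; the corank ≥ 2 sector of ranks ≥ 3 is
S7a ∧ S7b ∧ S7′ with S7b = R3 (R1 FCS⁺) (R2β R2α). -/
theorem MinimalCounterexampleInAcl_of :
    Summit.Schanuel.Schanuel.Theses.RigidCore.MinimalCounterexampleInAcl :=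
  crux_of_pureTwistedResidue_of_corankGeTwo stub_pureTwistedResidue corankGeTwo_of_stubs

-- The equivalent compositions `(stub_crux_iff_residues_of_genericSparsity stub_genericCosetLineSparsity).2 ⟨R₃, S7′⟩` and
-- `(stub_geThree_iff_relResidue_of_genericSparsity stub_genericCosetLineSparsity).2 S7′` use the tree theorems of
-- Theorems/RigidCoreMinimalCounterexampleInAclOfGenericResidues (p159089, ACCEPTED); that module is not imported here only because the skeleton was
-- published before the farm had rebuilt it — any later edit may import it and switch.

/-- Read-back (gen 33, tree): modulo gen 31's FCS⁺ the crux is EQUIVALENT to R₃ ∧ S7′ (`stub_crux_iff_residues_of_fcsPlus`,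
Theorems/…OfResidues, p156632) and item 14744 to S7′ (`stub_geThree_iff_relResidue_of_fcsPlus`). -/
example (hF : ∀ (ι : Type) [Fintype ι] (i₀ : ι) (W : Set (ι ⊕ ι → ℂ)) (c : ℂ) (J : Set ℤ) (q : ℤ → ι → ℂ) (Λ : Submodule ℤ (ι → ℤ)), Literature.NumberTheory.Transcendental.IsZariskiClosed ℂ W → Literature.NumberTheory.Transcendental.zariskiDim ℂ W + ((Module.finrank ℤ ↥Λ : ℕ) : WithBot ℕ∞) < ((Fintype.card ι : ℕ) : WithBot ℕ∞) → (∀ j ∈ J, LinearIndependent ℚ (q j) ∧ Sum.elim (q j) (Complex.exp ∘ q j) ∈ W ∧ q j i₀ = c + 2 * ↑Real.pi * Complex.I * (j : ℂ)) → (∀ ω : ι → ℂ, Set.Finite {j : ℤ | j ∈ J ∧ Complex.exp ∘ q j = ω}) → (∀ M ∈ Λ, ∀ j ∈ J, ∀ j' ∈ J, (∑ i, (M i : ℂ) * q j i) = ∑ i, (M i : ℂ) * q j' i) → (∀ J' ⊆ J, (∃ δ : ℝ, 0 < δ ∧ ∀ N₀ : ℕ, ∃ N : ℕ, N₀ ≤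 N ∧ ∃ a : ℤ, δ * (N : ℝ) ≤ (Set.ncard {j : ℤ | j ∈ Finset.Ico a (a + (N : ℤ)) ∧ j ∈ J'} : ℝ)) → ∀ M : ι → ℤ, (∀ m : ℤ, m ≠ 0 → m • M ∉ Λ) → Set.Infinite ((fun j => ∑ i, (M i : ℂ) * q j i) '' J')) → ∀ δ : ℝ, 0 < δ → ∃ N₀ : ℕ, ∀ N : ℕ, N₀ ≤ N → ∀ a : ℤ, (Set.ncard {j : ℤ | j ∈ Finset.Ico a (a + (N : ℤ)) ∧ j ∈ J} : ℝ) < δ * (N : ℝ)) :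
    Summit.Schanuel.Schanuel.Theses.RigidCore.MinimalCounterexampleInAcl ↔ ((∀ (x : Fin 2 → ℂ), x ∈ Summit.Schanuel.Schanuel.Cruxes.MinimalCounterexampleInAcl.KernelArithmeticSelection.firstFailures 2 → (∀ M : Fin 2 → ℤ, M ≠ 0 → Transcendental ℚ (Complex.exp (∑ i, (M i : ℂ) * x i))) → Transcendental ↥(IntermediateField.adjoin ℚ (Set.range x ∪ Set.range (Complex.exp ∘ x))) (Complex.exp (x 0 ^ 2)) → Transcendental ↥(IntermediateField.adjoin ℚ (Set.range x ∪ Set.range (Complex.exp ∘ x))) (Complex.exp (x 0 * x 1)) → Transcendental ↥(IntermediateField.adjoin ℚ (Set.range x ∪ Set.range (Complex.exp ∘ x))) (Complex.exp (x 1 ^ 2)) → Transcendental ↥(IntermediateField.adjoin ℚ (Set.range x ∪ Set.range (Complex.exp ∘ x))) (Complex.exp (Complex.I * x 0)) → Transcendental ↥(IntermediateField.adjoin ℚ (Set.range x ∪ Set.range (Complex.exp ∘ x))) (Complex.exp (Complex.I * x 1)) → ∀ i, x i ∈ Summit.Schanuel.Schanuel.Theorems.AclSubsetLogFreeCore.Negative.expAcl)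 ∧ (∀ (n r : ℕ), 3 ≤ n → r + 2 ≤ n → ∀ (x : Fin n → ℂ), x ∈ Summit.Schanuel.Schanuel.Cruxes.MinimalCounterexampleInAcl.KernelArithmeticSelection.firstFailures n → (∀ i : Fin n, (i : ℕ) < r → IsAlgebraic ℚ (Complex.exp (x i))) → (∀ M : Fin n → ℤ, (∃ i : Fin n, r ≤ (i : ℕ) ∧ M i ≠ 0) → Transcendental ℚ (Complex.exp (∑ i, (M i : ℂ) * x i))) → (∀ i : Fin n, (i : ℕ) < r → x i ∈ Summit.Schanuel.Schanuel.Theorems.AclSubsetLogFreeCore.Negative.expAcl) → ∀ i, x i ∈ Summit.Schanuel.Schanuel.Theorems.AclSubsetLogFreeCore.Negative.expAcl)) :=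
  stub_crux_iff_residues_of_fcsPlus hF

/-! ## The LOSSLESS form of the open set (gen 30, sorry-free) -/

/-- **(S*) ⟺ R₃ ∧ L ∧ S7′ — three NECESSARY residues (lead c14, sorry-free).**  `L` := the log coordinates of every normal-form first
failure of rank `n ≥ 3` with `r ≤ n − 2` log coordinates are in `acl(∅)`.  Each conjunct is a special case of (S*); conversely
R₃ ∧ (L ⟹ S7′'s hypothesis) give (S*).  S7b — hence FCS⁺ — is a SUFFICIENT route to `L` (`corankGeTwo_logCoords_of_stubs`);
unconditionally `L` holds modulo the period lattice (`stub_corankGeTwo_logCombosModPeriod`, Theorems/…CorankGeTwoLogPartModPeriod). -/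
theorem crux_iff_threeNecessaryResidues :
    Summit.Schanuel.Schanuel.Theses.RigidCore.MinimalCounterexampleInAcl ↔
      ((∀ (x : Fin 2 → ℂ), x ∈ firstFailures 2 →
          (∀ M : Fin 2 → ℤ, M ≠ 0 → Transcendental ℚ (cexp (∑ i, (M i : ℂ) * x i))) →
          Transcendental ↥(IntermediateField.adjoin ℚ (range x ∪ range (cexp ∘ x))) (cexp (x 0 ^ 2)) →
          Transcendental ↥(IntermediateField.adjoin ℚ (range x ∪ range (cexp ∘ x))) (cexp (x 0 * x 1)) →
          Transcendental ↥(IntermediateField.adjoin ℚ (range x ∪ range (cexp ∘ x))) (cexp (x 1 ^ 2)) →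
          Transcendental ↥(IntermediateField.adjoin ℚ (range x ∪ range (cexp ∘ x))) (cexp (I * x 0)) →
          Transcendental ↥(IntermediateField.adjoin ℚ (range x ∪ range (cexp ∘ x))) (cexp (I * x 1)) →
          ∀ i, x i ∈ expAcl) ∧
        (∀ (n r : ℕ), 3 ≤ n → r + 2 ≤ n → ∀ x : Fin n → ℂ, x ∈ firstFailures n →
          (∀ i : Fin n, (i : ℕ) < r → IsAlgebraic ℚ (cexp (x i))) →
          (∀ M : Fin n → ℤ, (∃ i : Fin n, r ≤ (i : ℕ) ∧ M i ≠ 0) → Transcendental ℚ (cexp (∑ i, (M i : ℂ) * x i))) →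
          ∀ i : Fin n, (i : ℕ) < r → x i ∈ expAcl) ∧
        (∀ (n r : ℕ), 3 ≤ n → r + 2 ≤ n → ∀ x : Fin n → ℂ, x ∈ firstFailures n →
          (∀ i : Fin n, (i : ℕ) < r → IsAlgebraic ℚ (cexp (x i))) →
          (∀ M : Fin n → ℤ, (∃ i : Fin n, r ≤ (i : ℕ) ∧ M i ≠ 0) → Transcendental ℚ (cexp (∑ i, (M i : ℂ) * x i))) →
          (∀ i : Fin n, (i : ℕ) < r → x i ∈ expAcl) → ∀ i, x i ∈ expAcl)) := by
  constructor
  · intro h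
    have h2 := crux_iff_pureTwistedResidue_and_corankGeTwo.1 h
    exact ⟨h2.1, fun n r hn hr x hx halg hpure i _ => h2.2 n r hn hr x hx halg hpure i,
      fun n r hn hr x hx halg hpure _ => h2.2 n r hn hr x hx halg hpure⟩
  · rintro ⟨hR, hL, hS⟩
    exact crux_of_pureTwistedResidue_of_corankGeTwo hR fun n r hn hr x hx halg hpure =>
      hS n r hn hr x hx halg hpure (hL n r hn hr x hx halg hpure)

/-- Read-back: the registered stubs imply the three necessary residues. -/
example : Summit.Schanuel.Schanuel.Theses.RigidCore.MinimalCounterexampleInAcl :=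
  crux_iff_threeNecessaryResidues.2 ⟨stub_pureTwistedResidue, corankGeTwo_logCoords_of_stubs, stub_corankGeTwo_relResidue⟩

/-! ## Sorry-free read-backs for the rank-2 residue (unchanged since gen 21) -/

/-- **Stub R₃ from the crux `SparsityTwo` (stmt-Schanuel-0971)** (via pure sparsity and the landed pure glue). -/
theorem stub_pureTwistedResidue_of_sparsityTwo (hSp : Summit.Schanuel.Schanuel.Theses.RigidCore.SparsityTwo) :
    ∀ (x : Fin 2 → ℂ), x ∈ firstFailures 2 →
      (∀ M : Fin 2 → ℤ, M ≠ 0 → Transcendental ℚ (cexp (∑ i, (M i : ℂ) * x i))) →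
      Transcendental ↥(IntermediateField.adjoin ℚ (range x ∪ range (cexp ∘ x))) (cexp (x 0 ^ 2)) →
      Transcendental ↥(IntermediateField.adjoin ℚ (range x ∪ range (cexp ∘ x))) (cexp (x 0 * x 1)) →
      Transcendental ↥(IntermediateField.adjoin ℚ (range x ∪ range (cexp ∘ x))) (cexp (x 1 ^ 2)) →
      Transcendental ↥(IntermediateField.adjoin ℚ (range x ∪ range (cexp ∘ x))) (cexp (I * x 0)) →
      Transcendental ↥(IntermediateField.adjoin ℚ (range x ∪ range (cexp ∘ x))) (cexp (I * x 1)) →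
      ∀ i, x i ∈ expAcl :=
  fun x hx hpure _ _ _ _ _ => stub_rankTwo_pureExp_of_pureSparsityTwo (sparsityTwo_imp_pureSparsityTwo hSp) x hx hpure

/-- (S*) ⟺ item stmt-14744 under the crux `SparsityTwo` (stmt-0971) — the landed glue stmt-14765 through the twisted split. -/
theorem crux_iff_geThree_of_sparsityTwo (hSp : Summit.Schanuel.Schanuel.Theses.RigidCore.SparsityTwo) :
    Summit.Schanuel.Schanuel.Theses.RigidCore.MinimalCounterexampleInAcl ↔
      Summit.Schanuel.Schanuel.Theses.RigidCore.MinimalCounterexampleInAclGeThree :=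
  ⟨minimalCounterexampleInAclGeThree_of_minimalCounterexampleInAcl,
    crux_of_twistedResidue_of_geThree (stub_pureTwistedResidue_of_sparsityTwo hSp)⟩

/-- **Exact dependency of (S*) on its sibling chains (c9, updated gen 31).**  (S*) follows from the three RESIDUAL ATOMS of crux
stmt-Schanuel-0971's line `cusp-germ-schneider-sparsity` together with item stmt-Schanuel-14744 (= S7a ∧ S7b ∧ S7′ here). -/
theorem crux_of_residualAtoms_of_geThree
    (h₃ : Summit.Schanuel.Schanuel.Cruxes.SparsityTwo.CuspGermSchneiderSparsity.WildCuspAtomShallow)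
    (h₂ : Summit.Schanuel.Schanuel.Cruxes.SparsityTwo.CuspGermSchneiderSparsity.InhomogeneousCuspAtomShallow)
    (h₁ : Summit.Schanuel.Schanuel.Cruxes.SparsityTwo.CuspGermSchneiderSparsity.LinearCuspAtom)
    (hG : Summit.Schanuel.Schanuel.Theses.RigidCore.MinimalCounterexampleInAclGeThree) :
    Summit.Schanuel.Schanuel.Theses.RigidCore.MinimalCounterexampleInAcl :=
  (crux_iff_geThree_of_sparsityTwo
    (Summit.Schanuel.Schanuel.Cruxes.SparsityTwo.CuspGermSchneiderSparsity.sparsityTwo_of_residualAtoms h₃ h₂ h₁)).2 hG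

/-- **SELECTION IS SLICE FINITENESS (c9, every rank, sorry-free).**  For a ℚ-linearly independent `x`, the conclusion of (S*) at `x`
holds iff some `∅`-definable subset of the mate class `locusMates x` that contains `x` is finite. -/
theorem expAcl_iff_finite_definable_slice {x : Fin n → ℂ} (hx : LinearIndependent ℚ x) :
    (∀ i, x i ∈ expAcl) ↔
      ∃ S : Set (Fin n → ℂ), S ⊆ locusMates x ∧ x ∈ S ∧ S.Finite ∧ (∅ : Set ℂ).Definable Language.expRing S := by
  constructor
  · intro h
    choose s hsfin hsdef hxs using h
    refine ⟨locusMates x ∩ ⋂ i, {y : Fin n → ℂ | y i ∈ s i}, Set.inter_subset_left, ?_, ?_, ?_⟩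
    · exact ⟨self_mem_locusMates x hx, Set.mem_iInter.2 fun i => hxs i⟩
    · refine (Set.Finite.pi (t := s) fun i => hsfin i).subset ?_
      intro y hy
      exact Set.mem_univ_pi.2 fun i => Set.mem_iInter.1 hy.2 i
    · refine (locusMates_definable x).inter (Set.definable_iInter_of_finite fun i => ?_)
      have e : {y : Fin n → ℂ | y i ∈ s i} = (fun g : Fin n → ℂ => g ∘ fun _ : Fin 1 => i) ⁻¹' {v : Fin 1 → ℂ | v 0 ∈ s i} := by
        ext y; simp
      rw [e]
      exact (hsdef i).preimage_comp _
  · rintro ⟨S, -, hxS, hSfin, hSdef⟩ i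
    exact ⟨(fun y : Fin n → ℂ => y i) '' S, hSfin.image _,
      Summit.Schanuel.Schanuel.Theorems.MinimalCounterexampleInAcl.Negative.definable₁_image_eval hSdef i, ⟨x, hxS, rfl⟩⟩

/-- Sanity (vocabulary check, sorry-free): the crux's conclusion is literally membership in the tree's `expAcl`. -/
example (h : Summit.Schanuel.Schanuel.Theses.RigidCore.MinimalCounterexampleInAcl) (x : Fin n → ℂ)
    (hx : x ∈ firstFailures n) (i : Fin n) : x i ∈ expAcl :=
  h n x hx.1 hx.2.1 hx.2.2 i

end Summit.Schanuel.Schanuel.Cruxes.MinimalCounterexampleInAcl.KernelArithmeticSelection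

end
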